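import Summits.CriticalPhenomena.PercolationContinuityZ3.Theorems.Transplant.SkelPhiNegReachFloors
import Summits.CriticalPhenomena.PercolationContinuityZ3.Theorems.Transplant.SkelPhiNegReachRecsK
import HarnessLib

/-!
# N1 (the `{±1}` node), (C) column under (ζ′) — file (C-S10-K): FROM THE PRIMITIVE FLOORS TO THE ROUND BUDGETS WITH THE BOX MULTIPLIER `kq`
# (the twin of §1–§2 of `SkelPhiNegReachFloors` (C-S10, p302688); NEG-SCOPE §B.19 (ζ′): the arrival box is `b₀ = r/4 = 10·kq` strides, so the
# localisation rounds start `kq` times wider): at the record values `Skelφ.CorrRec.*`, from (P1) `2000·(T + 2) ≤ n`, (P2) `2000·(T + 2)·U ≤ nℓ − n`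
# (kq-FREE, as the record), **(P3-K) `W_A ≤ 24kq·n`**, **(P4-K) `U·(L0_A + 1) ≤ 12kq·Δ`** (stmt-g16's `NegB.aWTA_le` / `NegB.U_bLTA_le`), with `|v| ≤ n`,
# `nℓ − n < Δ ≤ nℓ` (`Δ = modulus n h v v_β`, `U = n + |h|`): §1 **`NA_leK`** (`N_A + 1 ≤ 25kq`), **`NB_leK`** (`L0_B ≤ 49kq·n + 25kq·T`,
# `N_B + 1 ≤ 101kq`), **`Uqy_leK`** (`U·q_y ≤ Δ + 2U + 101kq·T·U`); §2 **`floors_roundsK`** (the small-box floors of both localisation segments at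
# `77kq·Δ` / `76kq·Δ·n`, the join floors, and the step budget `N_A + N_B + 2 + 800kq ≤ 926kq`). The band and target floors: (C-S10b-K)
# `SkelPhiNegReachFloorsBK`. The case `kq = 1` is the record (C-S10).

builds on p205010 (kernel theorem, internal audit signed; external expert review pending) — nothing in this file uses p205010; nothing here is a
claim about the open node `SamePDropOfSkeletonNeg₁`.
Lane `prim-bschramm`, seat `prim-bschramm-p5` (gen 11; (C) lineage); helper file (`--supports stmt-CriticalPhenomena-4575`).
[cite: KozmaNitzan2024, §4 Lemma 12 (pp. 23–25)] [cite: MartineauTassion2017, §4.3 Lemma 4.2]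
-/

noncomputable section

namespace Summit.CriticalPhenomena.PercolationContinuityZ3.Theorems

namespace Transplant

namespace Skelφ

namespace CorrRec

open Literature.Probability.Percolation Literature.Probability.LatticeModels
open Literature.Probability.Percolation.KozmaNitzan.Cells (oth oth_ne sgOf sgOf_sign eq_oth_of_ne)
open TwoAxis.Para (modulus)
open ChainPlanar ChainPara

section UnitsK

variable {kq n ℓ T : ℕ} {h v vβ aW bL : ℤ}
  (hkq : 1 ≤ kq) (hn : 1 ≤ n) (hvn : |v| ≤ n) (hΔlo : (n : ℤ) * ℓ - n < modulus n h v vβ) (hΔhi : modulus n h v vβ ≤ (n : ℤ) * ℓ)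
  (P1 : 2000 * (T + 2) ≤ n) (P2 : 2000 * ((T : ℤ) + 2) * (shearUnit n h : ℤ) ≤ (n : ℤ) * ℓ - n)

/-! ## §1 Unit facts with the box multiplier -/

include hkq hn hΔlo hΔhi P2 in
/-- **`N_A + 1 ≤ 25kq`** under (P2) and (P4-K). [folklore] -/
theorem NA_leK (P4 : (shearUnit n h : ℤ) * (((L0A bL : ℕ) : ℤ) + 1) ≤ 12 * (kq : ℤ) * modulus n h v vβ) : NA n ℓ h T bL + 1 ≤ 25 * kq := by
  have hsT := hsT_of_floors (v := v) (vβ := vβ) hn hΔlo hΔhi P2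
  have h1 := UsA_ge (v := v) (vβ := vβ) (ℓ := ℓ) hn hΔhi
  obtain ⟨f1, f2, f3⟩ := U_floor (v := v) (vβ := vβ) hΔlo P2
  have hn1 : (1 : ℤ) ≤ n := by exact_mod_cast hn
  have hkq1 : (1 : ℤ) ≤ kq := by exact_mod_cast hkq
  have hU0 : (0 : ℤ) < (shearUnit n h : ℤ) := by have := n_le_U n h; linarith
  have hT0 : (0 : ℤ) ≤ T := by positivity
  set d := (sA n ℓ h - T).toNat with hd
  have hd1 : (d : ℤ) = sA n ℓ h - T := Int.toNat_of_nonneg (by linarith)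
  have hdpos : 0 < d := by omega
  set U : ℤ := (shearUnit n h : ℤ) with hUdef
  set Δ : ℤ := modulus n h v vβ with hΔdef
  have hkU : (0 : ℤ) ≤ (kq : ℤ) * U := by positivity
  have hkTU : (0 : ℤ) ≤ (kq : ℤ) * ((T : ℤ) * U) := by positivity
  have hkΔ : 2000 * ((T : ℤ) + 2) * U * (kq : ℤ) ≤ Δ * (kq : ℤ) := mul_le_mul_of_nonneg_right f1 (by positivity)
  have key : ((L0A bL : ℕ) : ℤ) < 25 * (kq : ℤ) * (d : ℤ) := by
    by_contra hc
    have hc := not_lt.1 hc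
    have e1 : U * (25 * (kq : ℤ) * (d : ℤ)) ≤ U * ((L0A bL : ℕ) : ℤ) := mul_le_mul_of_nonneg_left hc hU0.le
    have e2 : U * (d : ℤ) ≥ Δ - 3 * U - (T : ℤ) * U := by
      rw [hd1]; have : U * (sA n ℓ h - T) = U * sA n ℓ h - (T : ℤ) * U := by ring
      linarith
    have e3 : 25 * (kq : ℤ) * (Δ - 3 * U - (T : ℤ) * U) ≤ 25 * (kq : ℤ) * (U * (d : ℤ)) := mul_le_mul_of_nonneg_left e2 (by positivity)
    have e5 : U * ((L0A bL : ℕ) : ℤ) + U ≤ 12 * (kq : ℤ) * Δ := by linarith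
    have e6 : (1 : ℤ) * U ≤ (kq : ℤ) * U := mul_le_mul_of_nonneg_right hkq1 hU0.le
    linarith
  have key' : L0A bL < 25 * kq * d := by exact_mod_cast key
  unfold NA
  rw [← hd]
  have := (Nat.div_lt_iff_lt_mul hdpos).2 key'
  omega

include hkq hn hvn hΔlo hΔhi P1 P2 in
/-- **`L0_B ≤ 49kq·n + 25kq·T`** and **`N_B + 1 ≤ 101kq`** under (P1)–(P4-K). [folklore] -/
theorem NB_leK (P3 : ((WA n aW : ℕ) : ℤ) ≤ 24 * (kq : ℤ) * n) (P4 : (shearUnit n h : ℤ) * (((L0A bL : ℕ) : ℤ) + 1) ≤ 12 * (kq : ℤ) * modulus n h v vβ) :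
    ((L0B n ℓ h v T aW bL : ℕ) : ℤ) ≤ 49 * (kq : ℤ) * n + 25 * (kq : ℤ) * T ∧ NB n ℓ h v T aW bL + 1 ≤ 101 * kq := by
  have hNA := NA_leK (v := v) (vβ := vβ) (T := T) (bL := bL) hkq hn hΔlo hΔhi P2 P4
  have hNA' : ((NA n ℓ h T bL : ℕ) : ℤ) + 1 ≤ 25 * (kq : ℤ) := by exact_mod_cast hNA
  have hT0 : (0 : ℤ) ≤ T := by positivity
  have hv0 : (0 : ℤ) ≤ |v| := abs_nonneg v
  have hn0 : (0 : ℤ) ≤ n := by positivity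
  have hkq1 : (1 : ℤ) ≤ kq := by exact_mod_cast hkq
  have hL : ((L0B n ℓ h v T aW bL : ℕ) : ℤ) ≤ 49 * (kq : ℤ) * n + 25 * (kq : ℤ) * T := by
    unfold L0B; push_cast
    have h1 : (((NA n ℓ h T bL : ℕ) : ℤ) + 1) * ((T : ℤ) + |v|) ≤ 25 * (kq : ℤ) * ((T : ℤ) + |v|) := mul_le_mul_of_nonneg_right hNA' (by positivity)
    have h2 : 25 * (kq : ℤ) * |v| ≤ 25 * (kq : ℤ) * n := mul_le_mul_of_nonneg_left hvn (by positivity)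
    linarith
  refine ⟨hL, ?_⟩
  have hTn : 2000 * T ≤ n := by omega
  have hTn' : 2000 * (kq : ℤ) * T ≤ (kq : ℤ) * n := by
    have h0 : (2000 * T : ℤ) ≤ n := by exact_mod_cast hTn
    have := mul_le_mul_of_nonneg_left h0 (show (0 : ℤ) ≤ kq by positivity)
    linarith
  have hkn : (1 : ℤ) ≤ (kq : ℤ) * n := by
    have := mul_le_mul hkq1 (show (1 : ℤ) ≤ n from by exact_mod_cast hn) (by norm_num) (by positivity)
    linarith
  have hL' : L0B n ℓ h v T aW bL < 101 * kq * (n - T) := by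
    have : ((L0B n ℓ h v T aW bL : ℕ) : ℤ) < 101 * (kq : ℤ) * ((n : ℤ) - T) := by linarith
    have hTn'' : T ≤ n := by omega
    zify [hTn'']; exact this
  unfold NB
  have hd : 0 < n - T := by omega
  have := (Nat.div_lt_iff_lt_mul hd).2 hL'
  omega

include hkq hn hvn hΔlo hΔhi P1 P2 in
/-- **`U·q_y ≤ Δ + 2U + 101kq·T·U`**. [folklore] -/
theorem Uqy_leK (P3 : ((WA n aW : ℕ) : ℤ) ≤ 24 * (kq : ℤ) * n) (P4 : (shearUnit n h : ℤ) * (((L0A bL : ℕ) : ℤ) + 1) ≤ 12 * (kq : ℤ) * modulus n h v vβ) :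
    (shearUnit n h : ℤ) * ((qy n ℓ h v T aW bL : ℕ) : ℤ) ≤
      modulus n h v vβ + 2 * (shearUnit n h : ℤ) + 101 * (kq : ℤ) * (T : ℤ) * (shearUnit n h : ℤ) := by
  obtain ⟨-, hNB⟩ := NB_leK (vβ := vβ) hkq hn hvn hΔlo hΔhi P1 P2 P3 P4
  obtain ⟨uq, -⟩ := UQ_le (v := v) (vβ := vβ) (ℓ := ℓ) hn hΔlo hΔhi
  have hNB' : ((NB n ℓ h v T aW bL : ℕ) : ℤ) + 1 ≤ 101 * (kq : ℤ) := by exact_mod_cast hNB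
  have hU : (0 : ℤ) ≤ (shearUnit n h : ℤ) := by positivity
  have hT0 : (0 : ℤ) ≤ T := by positivity
  unfold qy; push_cast
  have h1 : (((NB n ℓ h v T aW bL : ℕ) : ℤ) + 1) * T ≤ 101 * (kq : ℤ) * T := mul_le_mul_of_nonneg_right hNB' hT0
  have h2 : (shearUnit n h : ℤ) * ((((NB n ℓ h v T aW bL : ℕ) : ℤ) + 1) * T) ≤ (shearUnit n h : ℤ) * (101 * (kq : ℤ) * T) :=
    mul_le_mul_of_nonneg_left h1 hU
  linarith

/-! ## §2 The floors of the rounds -/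

include hkq hn hvn hΔlo hΔhi P1 P2 in
/-- **The small-box floors of both localisation segments, the join floors and the step budget** from (P1)–(P4-K), in the (ζ′) scale
(`77kq·Δ`, `76kq·Δ·n`; budget `N_A + N_B + 2 + 800kq ≤ 926kq`). [cite: KozmaNitzan2024, §4 Lemma 12 (pp. 23–25)] -/
theorem floors_roundsK (P3 : ((WA n aW : ℕ) : ℤ) ≤ 24 * (kq : ℤ) * n) (P4 : (shearUnit n h : ℤ) * (((L0A bL : ℕ) : ℤ) + 1) ≤ 12 * (kq : ℤ) * modulus n h v vβ) :
    ((shearUnit n h : ℤ) * (((L0A bL : ℕ) : ℤ) + (Qw n ℓ h : ℕ) + T + (3 * (n * ℓ) / shearUnit n h + 1 : ℕ) + 1) ≤ 77 * (kq : ℤ) * modulus n h v vβ) ∧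
    (modulus n h v vβ * (((L0B n ℓ h v T aW bL : ℕ) : ℤ) + T + n) +
      |v| * ((shearUnit n h : ℤ) * (((L0A bL : ℕ) : ℤ) + (Qw n ℓ h : ℕ) + T + (3 * (n * ℓ) / shearUnit n h + 1 : ℕ) + 1)) ≤ 76 * (kq : ℤ) * modulus n h v vβ * n) ∧
    ((shearUnit n h : ℤ) * (((qy n ℓ h v T aW bL : ℕ) : ℤ) + (3 * (n * ℓ) / shearUnit n h + 1 : ℕ) + 1) ≤ 77 * (kq : ℤ) * modulus n h v vβ) ∧
    (modulus n h v vβ * (((L0B n ℓ h v T aW bL : ℕ) : ℤ) + T + n) +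
      |v| * ((shearUnit n h : ℤ) * (((qy n ℓ h v T aW bL : ℕ) : ℤ) + (3 * (n * ℓ) / shearUnit n h + 1 : ℕ) + 1)) ≤ 76 * (kq : ℤ) * modulus n h v vβ * n) ∧
    ((T : ℤ) + 1 ≤ sA n ℓ h) ∧ (T + 1 ≤ n) ∧ (NA n ℓ h T bL + NB n ℓ h v T aW bL + 2 + 800 * kq ≤ 926 * kq) ∧
    (((T : ℤ) + 2) * ((n + h.natAbs : ℕ) : ℤ) ≤ (n : ℤ) * ℓ + 1) ∧ (T ≤ n) := by
  obtain ⟨f1, f2, f3⟩ := U_floor (v := v) (vβ := vβ) hΔlo P2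
  obtain ⟨uq, lq⟩ := UQ_le (v := v) (vβ := vβ) (ℓ := ℓ) hn hΔlo hΔhi
  have ula := ULa_le (v := v) (vβ := vβ) (ℓ := ℓ) (n := n) (h := h) hΔlo
  have hsT := hsT_of_floors (v := v) (vβ := vβ) hn hΔlo hΔhi P2
  have hNA := NA_leK (v := v) (vβ := vβ) (T := T) (bL := bL) hkq hn hΔlo hΔhi P2 P4
  obtain ⟨l0b, hNB⟩ := NB_leK (vβ := vβ) hkq hn hvn hΔlo hΔhi P1 P2 P3 P4
  have uqy := Uqy_leK (vβ := vβ) hkq hn hvn hΔlo hΔhi P1 P2 P3 P4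
  have hU : (0 : ℤ) ≤ (shearUnit n h : ℤ) := by positivity
  have hn1 : (1 : ℤ) ≤ n := by exact_mod_cast hn
  have hkq1 : (1 : ℤ) ≤ kq := by exact_mod_cast hkq
  have hU1 : (1 : ℤ) ≤ (shearUnit n h : ℤ) := by have := n_le_U n h; linarith
  have hΔ : (0 : ℤ) < modulus n h v vβ := by linarith
  have hn0 : (0 : ℤ) ≤ n := by positivity
  have hT0 : (0 : ℤ) ≤ T := by positivity
  have hv0 : (0 : ℤ) ≤ |v| := abs_nonneg v
  have hTn' : 2000 * T ≤ n := by omega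
  have hTn : 2000 * (T : ℤ) ≤ n := by exact_mod_cast hTn'
  have hUU : (shearUnit n h : ℤ) = ((n + h.natAbs : ℕ) : ℤ) := rfl
  set U : ℤ := (shearUnit n h : ℤ) with hUdef
  set Δ : ℤ := modulus n h v vβ with hΔdef
  set Q : ℤ := ((Qw n ℓ h : ℕ) : ℤ)
  set La : ℤ := ((3 * (n * ℓ) / shearUnit n h + 1 : ℕ) : ℤ)
  set qY : ℤ := ((qy n ℓ h v T aW bL : ℕ) : ℤ)
  set LA : ℤ := ((L0A bL : ℕ) : ℤ)
  set LB : ℤ := ((L0B n ℓ h v T aW bL : ℕ) : ℤ)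
  -- scaled product facts
  have hkq0 : (0 : ℤ) ≤ kq := by positivity
  have hkΔ : Δ ≤ (kq : ℤ) * Δ := by have := mul_le_mul_of_nonneg_right hkq1 hΔ.le; linarith
  have hΔn : (0 : ℤ) ≤ Δ * n := by positivity
  have hkΔn : Δ * n ≤ (kq : ℤ) * (Δ * n) := by have := mul_le_mul_of_nonneg_right hkq1 hΔn; linarith
  have e4 : (kq : ℤ) * (2000 * (T : ℤ) * U) ≤ (kq : ℤ) * Δ := mul_le_mul_of_nonneg_left f3 hkq0
  have hTU0 : (0 : ℤ) ≤ (T : ℤ) * U := by positivity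
  have hA1 : U * (LA + Q + T + La + 1) ≤ 17 * (kq : ℤ) * Δ := by linarith
  have hB1 : U * (qY + La + 1) ≤ 6 * (kq : ℤ) * Δ := by linarith
  have hl := mul_le_mul_of_nonneg_left l0b hΔ.le
  have hΔT : Δ * (2000 * (T : ℤ)) ≤ Δ * n := mul_le_mul_of_nonneg_left hTn hΔ.le
  have hkΔT : (kq : ℤ) * (Δ * (2000 * (T : ℤ))) ≤ (kq : ℤ) * (Δ * n) := mul_le_mul_of_nonneg_left hΔT hkq0
  have hX0 : Δ * (LB + T + n) ≤ 51 * (kq : ℤ) * (Δ * n) := by linarith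
  have hA1v : |v| * (U * (LA + Q + T + La + 1)) ≤ n * (17 * (kq : ℤ) * Δ) := mul_le_mul hvn hA1 (by positivity) hn0
  have hB1v : |v| * (U * (qY + La + 1)) ≤ n * (6 * (kq : ℤ) * Δ) := mul_le_mul hvn hB1 (by positivity) hn0
  refine ⟨by linarith, by linarith, by linarith, by linarith, hsT, by omega, by omega, ?_, by omega⟩
  rw [← hUU]
  have : (0 : ℤ) ≤ ((T : ℤ) + 2) * U := by positivity
  linarith

end UnitsK

end CorrRec

end Skelφ

end Transplant

end Summit.CriticalPhenomena.PercolationContinuityZ3.Theorems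

end
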